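import Summits.BirchSwinnertonDyer.Rank1Residual.GaloisImage.AbelianExtensionTorsion
import Summits.BirchSwinnertonDyer.Rank1Residual.X11b.QuadraticTorsionOfRam
import Literature.NumberTheory.GaloisRepresentations.AbsGaloisGroupOpenNormal
import Literature.NumberTheory.EllipticCurves.HeegnerPointsKolyvaginTorsionProofs
import Literature.NumberTheory.EllipticCurves.IwasawaTowerTorsionProofs
import Literature.NumberTheory.EllipticCurves.MazurTorsionGaloisStructureProofs
import Mathlib.FieldTheory.Galois.Abelian
import Mathlib.NumberTheory.Cyclotomic.Basic
import HarnessLib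

/-!
# `E[p]` irreducible, `p` odd ⟹ `E(K)[p] = 0` for every ABELIAN number field `K`, and
# `E(K_∞)[p^∞] = 0` over every `ℤ_p`-extension of an abelian base — team n1011, row T-R18c
# (the number-field / `ℤ_p`-tower layer over p11's core `GaloisImage/AbelianExtensionTorsion.lean`)

HONEST FRAMING (cell `b2b-bsdres`, run/shared/lean/b2b/bsd-rank1-residual/, verbatim in every
file): the goal of the cell is to DELETE the COMBINATION-SHAPED residual classes of the
Birch–Swinnerton-Dyer formula for ALL analytic-rank `≤ 1` elliptic curves over `ℚ` — "full BSD
formula for every rank `≤ 1` curve in class `C`" assembled STRICTLY from published theorems — so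
that the rank-`≤ 1` remainder becomes exactly the CONSTRUCTION-SHAPED classes, which are TYPED
(missing-input `Prop`s), NOT attempted. This is not "finishing BSD". Team n1011 (RESIDUAL-MAP §I
N10/N11), route (a) ROUTE-1 §15 'F-d PERIOD BRIDGE', sub-target R1-8 (OWNERS row T-R18c; the core
R1-8 (i) is row T-R18a = p11's `AbelianExtensionTorsion.lean`, p252010, imported here, not
re-proved): prove what is provable now; research route; TOOL lemmas, no class theorem; no claim
beyond the stated classes; labels unchanged; nothing booked. THEOREMS ONLY (no definition, no named
fact, no `sorry`).

## Content (pure Galois theory of `E[p]`; no reduction hypothesis at any prime)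

Input (p11, T-R18a): `geomTorsion_eq_zero_of_commutator_fixed_of_irreducible` — for `E = W/ℚ`
elliptic, `p` odd, `E[p]` irreducible, a point of `E[p] = E(ℚ̄)[p]` fixed by `[Γ_ℚ, Γ_ℚ]` is `O`
(statements there are at the `ℚ̄`-level: points fixed by a subgroup `U ⊇ [Γ_ℚ,Γ_ℚ]`, and the
`ℚ(μ_N)` pair in `rootsOfUnityFixer` vocabulary). This file adds the layer the tree's consumers are
typed in — `K`-RATIONAL points of an abstract number field `K` (Mathlib `IsAbelianGalois ℚ K`) and
`ℤ_p`-TOWERS (`ZpExtension K p`, `FixedPoints.addSubgroup κ.kerSubgroup (geomPrimaryTorsion … p)`):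

* `point_eq_zero_of_irreducible_of_isAbelianGalois` / `forall_…` / `torsionBy_eq_bot_…` (`K : Type`,
  plus a universe-polymorphic primed form via `exists_algEquiv_numberField_type`): **`E(K)[p] = 0`
  for every number field `K` abelian over `ℚ`** (any degree: `ℚ(ζ_N)` and its subfields,
  multi-quadratic fields, …). Proof: a `K`-point of order `p` gives a non-zero `Q ∈ E[p]` fixed by
  `Gal(ℚ̄/K')`, `K' ≅ K` the embedded copy (tree `X11b.Transvection.exists_fixed_geomTorsion_of_point`,
  `Automorphic.exists_range_absGaloisRestrict_eq_fixingSubgroup`), and `[Γ_ℚ,Γ_ℚ] ≤ Gal(ℚ̄/K')` for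
  abelian `K'` (tree `GaloisRepresentations.topologicalClosure_commutator_le_fixingSubgroup`); then
  p11's core. `…_of_isCyclotomicExtension`: `K = ℚ(ζ_S)` (Mathlib
  `IsCyclotomicExtension.isAbelianGalois`).
* `fixedPoints_kerSubgroup_eq_bot_of_irreducible_of_isAbelianGalois`: for every abelian number
  field `K` and EVERY `ℤ_p`-extension `K_∞/K`: **`E(K_∞)[p^∞] = E[p^∞]^{Gal(K̄/K_∞)} = 0`** — the
  previous item fed into the tree's pro-`p` ascent
  `WeierstrassCurve.fixedPoints_kerSubgroup_geomPrimaryTorsion_eq_bot` (Greenberg LNM 1716 §1 p. 62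
  / proof of Prop. 4.8). Specialisations `…_of_isCyclotomicExtension` (`K = ℚ(ζ_S)`; the `ℚ(ζ₃)` of
  the SubGss@3 chain), `…_of_finrank_eq_two` (quadratic `K`, the (ram)-FREE form of
  `X11b.fixedPoints_kerSubgroup_eq_bot_of_irr_of_ram`), and `fixedPoints_kerSubgroup_eq_bot_of_irreducible`
  (`K = ℚ`, ANY prime `p`: `E(ℚ)[p] = 0` from irreducibility alone, Mazur's leaf
  `not_exists_addOrderOf_eq_of_hasIrreducibleModPGaloisRep`).

## Why (consumers; what this removes)

(1) The (glob) hypothesis `H⁰(K_∞, E[p]) = 0` of every control / 'no finite `Λ`-submodule' /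
erratum-Lemma-2.1 argument is typed in the tree as
`FixedPoints.addSubgroup κ.kerSubgroup (geomPrimaryTorsion (W.baseChange K) p) = ⊥`; so far it was
fed from `Irr ∧ Ram` over quadratic `K` (`X11b.fixedPoints_kerSubgroup_eq_bot_of_irr_of_ram`) or
from good ORDINARY reduction at `p` over `ℚ` (`finite_fixedPoints_kerSubgroup_geomPrimaryTorsion_of_ordinary`).
On the additive rows of N11 — e.g. the SubGss@3 chain `Additive/XGssRankZeroCyclotomicThree*.lean`,
whose binder `hBK : ∀ κ : ZpExtension K 3, … = ⊥` over `K = ℚ(ζ₃)` is discharged in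
`XGssRankZeroCyclotomicThreeSharpFacts` ONLY through the census bit `hram : Ram V 3` — the tower
corollaries here discharge it from `Irr` alone (`…_of_isCyclotomicExtension` with `S = {3}`), with no
(ram) prime and no reduction hypothesis at `p`. (2) ROUTE-1 F-d v2 (ii) (row T-R18b, p09): cusps
of `X₀(N)` are rational over `ℚ(ζ_N)`; the `K`-rational form `E(ℚ(ζ_N))[p] = 0` is
`forall_point_eq_zero_of_irreducible_of_isCyclotomicExtension` (p11's `rootsOfUnityFixer` form is
the `ℚ̄`-level twin). (3) The quadratic `E(K)[p] = 0` itself is ALREADY in the tree WITHOUT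
`p ≠ 2` (x11b gen-17 `X11b.Transvection.torsion_eq_zero_of_irr`, Clifford for index two; Literature
`torsionBy_eq_bot_of_hasIrreducibleModPGaloisRep`) and is not restated; for `[K:ℚ] > 2` oddness of
`p` is genuinely needed (p11's file, module docstring: at `p = 2` an irreducible `E[2]` with
cyclic-cubic `2`-division field is rational over that abelian cubic field).

NOT claimed: anything at `p = 2`; anything for non-abelian `K`; any class theorem (TOOL lemmas).

References: J.-P. Serre, Invent. Math. 15 (1972) §4, §5.2 (iv), §5.4 [Serre1972]; R. Greenberg,
LNM 1716 (1999) §1 p. 62, §4 p. 109 [GreenbergLNM1716]; C. Wuthrich, Doc. Math. 19 (2014) Lemma 5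
(the semistable special case in print) [Wuthrich2014]; F. Castella, erratum to 'p-adic heights of
Heegner points and Beilinson–Flach classes', Lemma 2.1 (hypothesis (glob)) [Castella2018Erratum];
B. Mazur, Publ. IHÉS 47 (1977) Ch. III §5 [Mazur1977]; J. H. Silverman, GTM 106 (2009) VIII.§1
[SilvermanAEC2009].
-/

noncomputable section

open scoped Classical

universe u

namespace Summit.BirchSwinnertonDyer.Rank1Residual.GaloisImage

open WeierstrassCurve Field Literature.NumberTheory.EllipticCurves
  Literature.NumberTheory.GaloisRepresentations Literature.NumberTheory.EllipticCurves.Rank1Residual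

variable (W : WeierstrassCurve ℚ) [W.IsElliptic] (p : ℕ) [hp : Fact p.Prime]

/-! ### §1 `E(K)[p] = 0` over every abelian number field `K` -/

/-- **`E(K)[p] = 0` for `K/ℚ` abelian, `p` odd, `E[p]` irreducible** — point form, `K : Type`. For
`E = W` elliptic over `ℚ`, `p ≠ 2` prime with `E[p]` irreducible, `K` a number field Galois over `ℚ`
with commutative Galois group (`IsAbelianGalois ℚ K`), and `P ∈ E(K)` with `p • P = O`: `P = O`.
Proof: `P ≠ O` gives `0 ≠ Q ∈ E[p]` fixed by `Gal(ℚ̄/K')`, `K' ≅ K` the embedded copy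
(`exists_fixed_geomTorsion_of_point`, `exists_range_absGaloisRestrict_eq_fixingSubgroup`), and
`[Γ_ℚ, Γ_ℚ] ≤ Gal(ℚ̄/K')` since `K'/ℚ` is abelian (`topologicalClosure_commutator_le_fixingSubgroup`);
conclude by p11's core `geomTorsion_eq_zero_of_commutator_fixed_of_irreducible`. [cite: Serre1972, §4] [cite: SilvermanAEC2009, VIII.§1 (Galois action on points)] -/
theorem point_eq_zero_of_irreducible_of_isAbelianGalois (hp2 : p ≠ 2)
    (hirr : W.HasIrreducibleModPGaloisRep p) (K : Type) [Field K] [NumberField K]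
    [IsAbelianGalois ℚ K] (P : (W.baseChange K).toAffine.Point) (hP : (p : ℤ) • P = 0) :
    P = 0 := by
  by_contra hP0
  obtain ⟨Q, hQ0, hfix⟩ := X11b.Transvection.exists_fixed_geomTorsion_of_point W K P hP hP0
  obtain ⟨K', ⟨eK⟩, hrange⟩ :=
    Literature.NumberTheory.Automorphic.exists_range_absGaloisRestrict_eq_fixingSubgroup ℚ K
  haveI : FiniteDimensional ℚ K' := LinearEquiv.finiteDimensional eK.toLinearEquiv
  haveI hab : IsAbelianGalois ℚ K' := IsAbelianGalois.of_algHom eK.symm.toAlgHom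
  refine hQ0 (geomTorsion_eq_zero_of_commutator_fixed_of_irreducible W p hp2 hirr Q fun σ hσ ↦
    hfix σ ?_)
  rw [hrange]
  exact @topologicalClosure_commutator_le_fixingSubgroup ℚ (AlgebraicClosure ℚ) _ _ _ _ K' _ hab
    _ (Subgroup.le_topologicalClosure _ hσ)

/-- **`E(K)[p] = 0` for `K/ℚ` abelian** — `ℕ`-scalar form `∀ P, p • P = O → P = O`, the shape of the
hypothesis `hK` of the tree's tower lemmas (`fixedPoints_kerSubgroup_geomPrimaryTorsion_eq_bot`,
`natCard_selmerInvariants_eq_of_no_pTorsion`, …) for the base-changed curve `E/K`.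
[cite: Serre1972, §4] -/
theorem forall_point_eq_zero_of_irreducible_of_isAbelianGalois (hp2 : p ≠ 2)
    (hirr : W.HasIrreducibleModPGaloisRep p) (K : Type) [Field K] [NumberField K]
    [IsAbelianGalois ℚ K] : ∀ P : (W.baseChange K).toAffine.Point, p • P = 0 → P = 0 :=
  fun P hP ↦ point_eq_zero_of_irreducible_of_isAbelianGalois W p hp2 hirr K P
    (by rw [natCast_zsmul]; exact hP)

/-- **`E(K)[p] = 0` for `K/ℚ` abelian** — subgroup form `E(K)[p] = ⊥` (`K : Type`).
[cite: Serre1972, §4] -/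
theorem torsionBy_eq_bot_of_irreducible_of_isAbelianGalois (hp2 : p ≠ 2)
    (hirr : W.HasIrreducibleModPGaloisRep p) (K : Type) [Field K] [NumberField K]
    [IsAbelianGalois ℚ K] :
    AddSubgroup.torsionBy (W.baseChange K).toAffine.Point (p : ℤ) = ⊥ := by
  rw [eq_bot_iff]
  intro P hP
  rw [AddSubgroup.mem_bot]
  exact point_eq_zero_of_irreducible_of_isAbelianGalois W p hp2 hirr K P
    ((WeierstrassCurve.mem_torsionPoints_iff W K P).mp hP)

/-- **`E(K)[p] = 0` for `K/ℚ` abelian, `K` in any universe** (descended to a `ℚ`-isomorphic model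
in `Type` by a primitive element, `exists_algEquiv_numberField_type`, and transported by
`torsionBy_eq_bot_of_algEquiv`; `IsAbelianGalois` transports along `≃ₐ[ℚ]`). [cite: Serre1972, §4] -/
theorem torsionBy_eq_bot_of_irreducible_of_isAbelianGalois' (hp2 : p ≠ 2)
    (hirr : W.HasIrreducibleModPGaloisRep p) (K : Type u) [Field K] [NumberField K]
    [IsAbelianGalois ℚ K] :
    AddSubgroup.torsionBy (W.baseChange K).toAffine.Point (p : ℤ) = ⊥ := by
  obtain ⟨K₀, _, _, ⟨e⟩⟩ := exists_algEquiv_numberField_type K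
  haveI : IsAbelianGalois ℚ K₀ := IsAbelianGalois.of_algHom e.toAlgHom
  exact torsionBy_eq_bot_of_algEquiv W e
    (torsionBy_eq_bot_of_irreducible_of_isAbelianGalois W p hp2 hirr K₀)

/-- **Cyclotomic fields**: for `K = ℚ(ζ_S)` (`IsCyclotomicExtension S ℚ K`; abelian by Mathlib's
`IsCyclotomicExtension.isAbelianGalois`), `p` odd, `E[p]` irreducible: `E(K)[p] = 0` (`ℕ`-scalar
form). In particular `E(ℚ(ζ_N))[p] = 0` for every `N` — the field of definition of the cusps of
`X₀(N)` in ROUTE-1's F-d bridge — and `E(ℚ(ζ₃))[p] = 0` for the SubGss@3 chain. [cite: Serre1972, §4] -/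
theorem forall_point_eq_zero_of_irreducible_of_isCyclotomicExtension (hp2 : p ≠ 2)
    (hirr : W.HasIrreducibleModPGaloisRep p) (S : Set ℕ) (K : Type) [Field K] [NumberField K]
    [IsCyclotomicExtension S ℚ K] : ∀ P : (W.baseChange K).toAffine.Point, p • P = 0 → P = 0 := by
  haveI : IsAbelianGalois ℚ K := IsCyclotomicExtension.isAbelianGalois S ℚ K
  exact forall_point_eq_zero_of_irreducible_of_isAbelianGalois W p hp2 hirr K

/-! ### §2 `ℤ_p`-towers over an abelian base: `E(K_∞)[p^∞] = 0` -/

/-- **`E(K_∞)[p^∞] = 0` over EVERY `ℤ_p`-extension of an abelian number field**, from `E[p]`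
irreducible and `p` odd alone. For `E = W/ℚ` elliptic, `p ≠ 2` with `E[p]` irreducible, `K` a number
field abelian over `ℚ` and `κ` ANY `ℤ_p`-extension of `K` (cyclotomic, anticyclotomic, …): the
subgroup of `E[p^∞] = E(K̄)[p^∞]` fixed by `Gal(K̄/K_∞) = ker κ` is trivial. Proof: §1 gives
`E(K)[p] = 0`, and a pro-`p` group acting on a non-zero finite `p`-group has a non-zero fixed point
(tree `WeierstrassCurve.fixedPoints_kerSubgroup_geomPrimaryTorsion_eq_bot`). This is the (glob)
hypothesis `H⁰(K_∞, E[p]) = 0` of the control / 'no finite `Λ`-submodule' / erratum-Lemma-2.1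
arguments, now with NO (ram) multiplicative prime and NO reduction hypothesis at `p` (compare
`X11b.fixedPoints_kerSubgroup_eq_bot_of_irr_of_ram`, quadratic `K`, `Irr ∧ Ram`).
[cite: GreenbergLNM1716, §1 p. 62 and §4 p. 109 (the fixed-point principle)] [cite: Serre1972, §4] -/
theorem fixedPoints_kerSubgroup_eq_bot_of_irreducible_of_isAbelianGalois (hp2 : p ≠ 2)
    (hirr : W.HasIrreducibleModPGaloisRep p) (K : Type) [Field K] [NumberField K]
    [IsAbelianGalois ℚ K] (κ : ZpExtension K p) :
    FixedPoints.addSubgroup κ.kerSubgroup (geomPrimaryTorsion (W.baseChange K) p) = ⊥ := by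
  haveI : (W.baseChange K).IsElliptic := by rw [baseChange]; infer_instance
  exact (W.baseChange K).fixedPoints_kerSubgroup_geomPrimaryTorsion_eq_bot κ
    (forall_point_eq_zero_of_irreducible_of_isAbelianGalois W p hp2 hirr K)

/-- **`E(K_∞)[p^∞] = 0` over every `ℤ_p`-extension of a cyclotomic field `K = ℚ(ζ_S)`** (`p` odd,
`E[p]` irreducible) — the shape of the binder
`hBK : ∀ κ : ZpExtension K 3, FixedPoints.addSubgroup κ.kerSubgroup ((V.baseChange K).geomPrimaryTorsion 3) = ⊥`
of the SubGss@3 chain (`Additive/XGssRankZeroCyclotomicThree*.lean`, `K = ℚ(ζ₃)`), hitherto fed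
from `Irr ∧ Ram` (`X11b.fixedPoints_kerSubgroup_eq_bot_of_irr_of_ram`): now from `Irr` alone.
[cite: GreenbergLNM1716, §1 p. 62 and §4 p. 109] -/
theorem fixedPoints_kerSubgroup_eq_bot_of_irreducible_of_isCyclotomicExtension (hp2 : p ≠ 2)
    (hirr : W.HasIrreducibleModPGaloisRep p) (S : Set ℕ) (K : Type) [Field K] [NumberField K]
    [IsCyclotomicExtension S ℚ K] (κ : ZpExtension K p) :
    FixedPoints.addSubgroup κ.kerSubgroup (geomPrimaryTorsion (W.baseChange K) p) = ⊥ := by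
  haveI : IsAbelianGalois ℚ K := IsCyclotomicExtension.isAbelianGalois S ℚ K
  exact fixedPoints_kerSubgroup_eq_bot_of_irreducible_of_isAbelianGalois W p hp2 hirr K κ

/-- **`E(K_∞)[p^∞] = 0` over every `ℤ_p`-extension of a QUADRATIC field `K`** (`p` odd, `E[p]`
irreducible; quadratic ⇒ abelian via Mathlib `Algebra.IsQuadraticExtension`) — the (ram)-free form of
`X11b.fixedPoints_kerSubgroup_eq_bot_of_irr_of_ram` (the quadratic `E(K)[p] = 0` itself is x11b's
`torsion_eq_zero_of_irr`, even without `p ≠ 2`; the tower form was only in the tree under `Ram`).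
[cite: GreenbergLNM1716, §1 p. 62 and §4 p. 109] [cite: Castella2018Erratum, Lemma 2.1 (hypothesis (glob))] -/
theorem fixedPoints_kerSubgroup_eq_bot_of_irreducible_of_finrank_eq_two (hp2 : p ≠ 2)
    (hirr : W.HasIrreducibleModPGaloisRep p) (K : Type) [Field K] [NumberField K]
    (hK : Module.finrank ℚ K = 2) (κ : ZpExtension K p) :
    FixedPoints.addSubgroup κ.kerSubgroup (geomPrimaryTorsion (W.baseChange K) p) = ⊥ := by
  haveI : Algebra.IsQuadraticExtension ℚ K := { finrank_eq_two' := hK }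
  haveI : IsAbelianGalois ℚ K := {}
  exact fixedPoints_kerSubgroup_eq_bot_of_irreducible_of_isAbelianGalois W p hp2 hirr K κ

/-- **`E(ℚ_∞)[p^∞] = 0` over every `ℤ_p`-extension of `ℚ`** (in particular the cyclotomic one), for
ANY prime `p` with `E[p]` irreducible: `E(ℚ)[p] = 0` because a rational point of order `p` spans a
`Γ_ℚ`-stable line (Mazur's leaf `not_exists_addOrderOf_eq_of_hasIrreducibleModPGaloisRep`), then the
pro-`p` ascent. No reduction hypothesis at `p` (the tree's
`finite_fixedPoints_kerSubgroup_geomPrimaryTorsion_of_ordinary` needs good ordinary `p`): usable at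
an ADDITIVE `p` on every `Irr` row of N10/N11. [cite: GreenbergLNM1716, §1 p. 62 and §4 p. 109]
[cite: Mazur1977, Ch. III §5, p. 157 (a rational point of order `N` makes `ρ̄_{E,N}` reducible)] -/
theorem fixedPoints_kerSubgroup_eq_bot_of_irreducible (hirr : W.HasIrreducibleModPGaloisRep p)
    (κ : ZpExtension ℚ p) :
    FixedPoints.addSubgroup κ.kerSubgroup (geomPrimaryTorsion W p) = ⊥ := by
  refine W.fixedPoints_kerSubgroup_geomPrimaryTorsion_eq_bot κ fun P hP ↦ ?_
  by_contra hP0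
  exact not_exists_addOrderOf_eq_of_hasIrreducibleModPGaloisRep W hirr
    ⟨P, addOrderOf_eq_prime (by convert hP) hP0⟩

end Summit.BirchSwinnertonDyer.Rank1Residual.GaloisImage

end
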